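import Literature.Computability.Cryptography.RejectionSamplerArithFP
import Literature.Computability.QuantumComplexity.PseudoGaussianSamplerMachine
import Literature.Computability.Cryptography.CoinBlockLaws
import HarnessLib

/-!
# The Gaussian rejection sampler on a flat coin string: typed polynomial time, and its exact law on uniform coins

Topic `Computability/Cryptography`, grouping namespace `GaussRejMachine`; machine side of
`Probability/Distributions/GaussianRejectionSampler.lean` (the law `GaussRej.rejLaw θ c s N P w R` of `R`
rounds of GPV's SampleZ with exact rational arithmetic, and its distance
`GaussRej.tvDist_rejLaw_le_of_params` to the discrete Gaussian `D_{ℤ,√(π/θ),c}`) and of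
`RejectionSamplerArithFP.lean` (`GaussRejFP.accNumOf_codeFP`: the acceptance numerator is
typed polynomial time against the record `accCtxOf θ c s N P = (θ, c, 1ˢ, 1ᴺ, 1ᴾ, 1^{2ˢ})`). A machine
of the tree reads its coins as ONE uniform string; here the sampler is written on a flat string — round
`t` reads bits `[tK, tK + w + 1)` as the window offset `o` and bits `[tK + w + 1, (t+1)K)` as the
acceptance coin `u`, `K = w + 1 + P` — and we prove (everything PROVED, definitions with bodies, no named
fact):

* `readPair w P v` — the pair `(o, u) ∈ [0, 2^{w+1}) × [0, 2ᴾ)` read off a word of length `w + 1 + P`,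
  a BIJECTION (`readPair_bijective`), so that a uniform word reads as a uniform pair
  (`uniformVector_map_readPair`);
* `rejFlat θ c s N P w R l` — the sampler on a flat string (first accepted window point, `round c` if none),
  `rejFlat_succ_append` (one round on a word followed by the rest);
* **`uniformVector_map_rejFlat`** — on a uniform string of length `C ≥ R·K` its law IS `rejLaw θ c s N P w R`
  (induction on `R`: split the string at `K`, `uniformVector_map_vecSplit`, `uniformOfFintype_prod_eq_bind`);
  with `GaussRej.tvDist_rejLaw_le_of_params` this puts the machine's samples within the printed distance of
  `D_{ℤ,√(π/θ),c}`;
* the program against the record `rejCtx = (accCtx, 1ʷ, 1ᴿ)`: `attemptOf` (one round on a chunk, as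
  `(accepted?, value)`), `rejOf` (chunks by `strChunks`, attempts by `map`, first success by the
  `pick`-fold of `PseudoGaussianSamplerMachine.lean`, default `round c`), **`rejOf_codeFP`** (typed
  polynomial time in `(record, coins)`) and **`rejOf_rejCtxOf`** (`= rejFlat` at the record of the
  parameters, for coin strings of length `≥ R·K`).

## References

* C. Gentry, C. Peikert, V. Vaikuntanathan, *Trapdoors for hard lattices and new cryptographic
  constructions*, STOC 2008, §4.1 (SampleZ) [GentryPeikertVaikuntanathan2008].
* S. Arora, B. Barak, *Computational Complexity: A Modern Approach*, CUP 2009, Def. 7.1 (a probabilistic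
  machine reads a uniform random string), §1.3 (bounded loops) [AroraBarak2009].
-/

noncomputable section

namespace Literature.Computability.Cryptography

namespace GaussRejMachine

open PMF Literature.Probability.Distributions Literature.Probability.Distributions.GaussRej
open Literature.Computability.Complexity Literature.Computability.Complexity.CodeFP
  GaussRejFP Literature.Computability.QuantumComplexity
open Literature.Algebra.EuclideanLattices (encodeRat encodeRat_injective)

/-! ### Reading one round off a word -/

section Read

variable (w P : ℕ)

/-- The window offset read off a word: the value of its first `w + 1` bits. [cite: AroraBarak2009, Def. 7.1] -/
def readO (l : List Bool) : ℕ := bitsToNat (l.take (w + 1))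

/-- The acceptance coin read off a word: the value of the `P` bits after the first `w + 1`. [cite: AroraBarak2009, Def. 7.1] -/
def readU (l : List Bool) : ℕ := bitsToNat ((l.drop (w + 1)).take P)

/-- `readO < 2^{w+1}`. [folklore] -/
theorem readO_lt (l : List Bool) : readO w l < 2 ^ (w + 1) :=
  (bitsToNat_lt _).trans_le (Nat.pow_le_pow_right (by norm_num) (List.length_take_le _ _))

/-- `readU < 2ᴾ`. [folklore] -/
theorem readU_lt (l : List Bool) : readU w P l < 2 ^ P :=
  (bitsToNat_lt _).trans_le (Nat.pow_le_pow_right (by norm_num) (List.length_take_le _ _))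

/-- **The pair `(o, u)` read off a word of length `w + 1 + P`.** [cite: AroraBarak2009, Def. 7.1] -/
def readPair (v : List.Vector Bool (w + 1 + P)) : Fin (2 ^ (w + 1)) × Fin (2 ^ P) :=
  (⟨readO w v.toList, readO_lt w _⟩, ⟨readU w P v.toList, readU_lt w P _⟩)

/-- Reading is injective: the two blocks determine the word. [folklore] -/
theorem readPair_injective : Function.Injective (readPair w P) := by
  intro v v' h
  have h1 : readO w v.toList = readO w v'.toList := by
    have := congrArg (fun p => (p.1 : ℕ)) h; simpa [readPair] using this
  have h2 : readU w P v.toList = readU w P v'.toList := by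
    have := congrArg (fun p => (p.2 : ℕ)) h; simpa [readPair] using this
  unfold readO at h1
  unfold readU at h2
  have hl1 : (v.toList.take (w + 1)).length = (v'.toList.take (w + 1)).length := by simp
  have hl2 : ((v.toList.drop (w + 1)).take P).length = ((v'.toList.drop (w + 1)).take P).length := by simp
  have e1 := Literature.Computability.FineGrained.BruteForce.bitsToNat_injective_of_length_eq hl1 h1
  have e2 := Literature.Computability.FineGrained.BruteForce.bitsToNat_injective_of_length_eq hl2 h2
  have hd : v.toList.drop (w + 1) = (v.toList.drop (w + 1)).take P := by
    rw [List.take_of_length_le]; simp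
  have hd' : v'.toList.drop (w + 1) = (v'.toList.drop (w + 1)).take P := by
    rw [List.take_of_length_le]; simp
  refine List.Vector.eq _ _ ?_
  rw [← List.take_append_drop (w + 1) v.toList, ← List.take_append_drop (w + 1) v'.toList, e1, hd, hd', e2]

/-- **Reading is a bijection** `{0,1}^{w+1+P} ≃ [0, 2^{w+1}) × [0, 2ᴾ)`. [folklore] -/
theorem readPair_bijective : Function.Bijective (readPair w P) := by
  rw [Fintype.bijective_iff_injective_and_card]
  exact ⟨readPair_injective w P, by simp [card_vector, Fintype.card_prod, Fintype.card_fin, pow_add]⟩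

/-- **A uniform word reads as a uniform pair.** [cite: AroraBarak2009, Def. 7.1] -/
theorem uniformVector_map_readPair :
    (uniformOfFintype (List.Vector Bool (w + 1 + P))).map (readPair w P) =
      uniformOfFintype (Fin (2 ^ (w + 1)) × Fin (2 ^ P)) :=
  uniformOfFintype_map_equiv (Equiv.ofBijective _ (readPair_bijective w P))

end Read

/-! ### The sampler on a flat coin string and its law -/

section Flat

variable (θ c : ℚ) (s N P w : ℕ)

/-- **The rejection sampler on a flat coin string**: round by round, read `(o, u)`, accept the window point
`round c + o - 2ʷ` iff `u < accNum` of it; after `R` failed rounds output `round c`.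
[cite: GentryPeikertVaikuntanathan2008, §4.1 (SampleZ)] -/
def rejFlat : ℕ → List Bool → ℤ
  | 0, _ => round c
  | R + 1, l =>
      if readU w P l < accNum θ c s N P (round c + (readO w l : ℤ) - 2 ^ w) then round c + (readO w l : ℤ) - 2 ^ w
      else rejFlat R (l.drop (w + 1 + P))

/-- **One round on a word followed by the rest.** [folklore] -/
theorem rejFlat_succ_append (R : ℕ) (v : List.Vector Bool (w + 1 + P)) (rest : List Bool) :
    rejFlat θ c s N P w (R + 1) (v.toList ++ rest) =
      if accept θ c s N P w (readPair w P v) then window c w (readPair w P v).1 else rejFlat θ c s N P w R rest := by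
  have hlen : v.toList.length = w + 1 + P := v.toList_length
  have hO : readO w (v.toList ++ rest) = readO w v.toList := by
    unfold readO
    rw [List.take_append_of_le_length (by rw [hlen]; omega)]
  have hU : readU w P (v.toList ++ rest) = readU w P v.toList := by
    unfold readU
    rw [List.drop_append_of_le_length (by rw [hlen]; omega), List.take_append_of_le_length (by
      rw [List.length_drop, hlen]; omega)]
  have hdrop : (v.toList ++ rest).drop (w + 1 + P) = rest := by
    rw [List.drop_append_of_le_length (by rw [hlen]), List.drop_of_length_le (by rw [hlen]), List.nil_append]
  show (if readU w P (v.toList ++ rest) < accNum θ c s N P (round c + (readO w (v.toList ++ rest) : ℤ) - 2 ^ w) then _ else _) = _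
  rw [hO, hU, hdrop]
  rfl

/-- **The law of the flat sampler on uniform coins is `rejLaw`**: for a uniform string of length `C ≥ R·K`,
`K = w + 1 + P`. [cite: GentryPeikertVaikuntanathan2008, §4.1; AroraBarak2009, Def. 7.1] -/
theorem uniformVector_map_rejFlat : ∀ (R : ℕ) {C : ℕ} (_ : R * (w + 1 + P) ≤ C),
    (uniformOfFintype (List.Vector Bool C)).map (fun v => rejFlat θ c s N P w R v.toList) = rejLaw θ c s N P w R
  | 0, C, _ => by
    show (uniformOfFintype (List.Vector Bool C)).map (fun _ => round c) = PMF.pure (round c)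
    exact PMF.map_const _ _
  | R + 1, C, hC => by
    have hK : w + 1 + P ≤ C := le_trans (by rw [Nat.succ_mul]; omega) hC
    have hC' : R * (w + 1 + P) ≤ C - (w + 1 + P) := by
      rw [Nat.succ_mul] at hC; omega
    -- split the string at `K`
    have hsplit : (fun v : List.Vector Bool C => rejFlat θ c s N P w (R + 1) v.toList) =
        (fun p : List.Vector Bool (w + 1 + P) × List.Vector Bool (C - (w + 1 + P)) =>
          if accept θ c s N P w (readPair w P p.1) then window c w (readPair w P p.1).1
          else rejFlat θ c s N P w R p.2.toList) ∘ vecSplit (w + 1 + P) C hK := by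
      funext v
      have hv : v.toList = (vecSplit (w + 1 + P) C hK v).1.toList ++ (vecSplit (w + 1 + P) C hK v).2.toList := by
        simp [vecSplit]
      rw [Function.comp_apply]
      conv_lhs => rw [hv]
      exact rejFlat_succ_append θ c s N P w R _ _
    rw [hsplit, ← PMF.map_comp, uniformVector_map_vecSplit, uniformOfFintype_prod_eq_bind, PMF.map_bind]
    -- the suffix: by induction; the prefix: a uniform pair
    have hinner : ∀ p : List.Vector Bool (w + 1 + P),
        ((uniformOfFintype (List.Vector Bool (C - (w + 1 + P)))).map (Prod.mk p)).map
          (fun q : List.Vector Bool (w + 1 + P) × List.Vector Bool (C - (w + 1 + P)) =>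
            if accept θ c s N P w (readPair w P q.1) then window c w (readPair w P q.1).1 else rejFlat θ c s N P w R q.2.toList) =
          if accept θ c s N P w (readPair w P p) then PMF.pure (window c w (readPair w P p).1) else rejLaw θ c s N P w R := by
      intro p
      rw [PMF.map_comp]
      by_cases h : accept θ c s N P w (readPair w P p)
      · simp only [Function.comp_def, if_pos h]
        exact PMF.map_const _ _
      · simp only [Function.comp_def, if_neg h]
        exact uniformVector_map_rejFlat R hC'
    simp_rw [hinner]
    -- `rejLaw (R+1)` reads a uniform pair
    rw [rejLaw, ← uniformVector_map_readPair w P, PMF.bind_map]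
    rfl

end Flat

/-! ### The program against the record -/

section Program

/-- The record of the sampler: the acceptance record `(θ, c, 1ˢ, 1ᴺ, 1ᴾ, 1^{2ˢ})`, then `1ʷ`, `1ᴿ`. [folklore] -/
abbrev RejCtx : Type := AccCtx × ℕ × ℕ

/-- Its code. [folklore] -/
abbrev rejCtxE : RejCtx → List Bool := pairE accCtxE (pairE unE unE)

/-- The record of the parameters `θ c s N P w R`. [folklore] -/
def rejCtxOf (θ c : ℚ) (s N P w R : ℕ) : RejCtx := (accCtxOf θ c s N P, w, R)

/-- **One round on a chunk, as `(accepted?, value)`** against the record. [cite: GentryPeikertVaikuntanathan2008, §4.1] -/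
def attemptOf (r : RejCtx) (l : List Bool) : Bool × ℤ :=
  if readU r.2.1 r.1.2.2.2.2.1 l < accNumOf r.1 (round r.1.2.1 + (readO r.2.1 l : ℤ) - 2 ^ r.2.1)
  then (true, round r.1.2.1 + (readO r.2.1 l : ℤ) - 2 ^ r.2.1) else (false, 0)

/-- **The sampler against the record**: cut the coins into `R` chunks of width `K = w + 1 + P`, attempt each,
keep the first success (the `pick`-fold), default `round c`. [cite: GentryPeikertVaikuntanathan2008, §4.1] -/
def rejOf (r : RejCtx) (coins : List Bool) : ℤ :=
  let K := r.2.1 + 1 + r.1.2.2.2.2.1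
  let res := (((List.range r.2.2).map fun t => (coins.drop (t * K)).take K).map (attemptOf r)).foldl pick (false, 0)
  if res.1 then res.2 else round r.1.2.1

/-- The `pick`-fold realises "first accepted round, else continue" on consecutive chunks. [folklore] -/
theorem foldl_pick_chunks (θ c : ℚ) (s N P w : ℕ) :
    ∀ (R : ℕ) (coins : List Bool),
      (let res := (((List.range R).map fun t => (coins.drop (t * (w + 1 + P))).take (w + 1 + P)).map
          (attemptOf (rejCtxOf θ c s N P w R))).foldl pick (false, 0)
       if res.1 then res.2 else round c) = rejFlat θ c s N P w R coins
  | 0, coins => rfl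
  | R + 1, coins => by
    have hctx : ∀ R', attemptOf (rejCtxOf θ c s N P w R') =
        fun l => if readU w P l < accNum θ c s N P (round c + (readO w l : ℤ) - 2 ^ w)
          then (true, round c + (readO w l : ℤ) - 2 ^ w) else (false, 0) := fun R' => rfl
    rw [hctx] at *
    have ih := foldl_pick_chunks θ c s N P w R (coins.drop (w + 1 + P))
    rw [hctx] at ih
    rw [List.range_succ_eq_map, List.map_cons, List.map_map, List.map_cons, List.foldl_cons]
    simp only [zero_mul, List.drop_zero]
    -- the first chunk read off `coins` is read off its first `K` bits
    have hO : readO w (coins.take (w + 1 + P)) = readO w coins := by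
      unfold readO; rw [List.take_take, min_eq_left (by omega)]
    have hU : readU w P (coins.take (w + 1 + P)) = readU w P coins := by
      unfold readU
      rw [List.drop_take, List.take_take]
      congr 2
      omega
    rw [hO, hU]
    show (let res := List.foldl pick (pick (false, 0) _) _; if res.1 then res.2 else round c) = rejFlat θ c s N P w (R + 1) coins
    by_cases hacc : readU w P coins < accNum θ c s N P (round c + (readO w coins : ℤ) - 2 ^ w)
    · simp only [if_pos hacc, pick, Bool.false_eq_true, ↓reduceIte]
      rw [foldl_pick_of_fst _ _ rfl]
      simp only [↓reduceIte]
      rw [rejFlat, if_pos hacc]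
    · simp only [if_neg hacc, pick, Bool.false_eq_true, ↓reduceIte]
      rw [rejFlat, if_neg hacc, ← ih]
      -- the remaining chunks of `coins` are the chunks of `coins.drop K`
      have hch : (List.map ((fun t => List.take (w + 1 + P) (List.drop (t * (w + 1 + P)) coins)) ∘ Nat.succ) (List.range R)) =
          List.map (fun t => List.take (w + 1 + P) (List.drop (t * (w + 1 + P)) (List.drop (w + 1 + P) coins))) (List.range R) := by
        refine List.map_congr_left fun t _ => ?_
        simp only [Function.comp_apply, List.drop_drop]
        congr 2
        rw [Nat.succ_mul]; omega
      rw [hch]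

/-- **At the record of the parameters the program is the flat sampler.** [folklore] -/
theorem rejOf_rejCtxOf (θ c : ℚ) (s N P w R : ℕ) (coins : List Bool) :
    rejOf (rejCtxOf θ c s N P w R) coins = rejFlat θ c s N P w R coins :=
  foldl_pick_chunks θ c s N P w R coins

/-- The code of the argument `(record, coins)`. [folklore] -/
abbrev rejArgE : RejCtx × List Bool → List Bool := pairE rejCtxE strE

/-- The attempt against the record is typed polynomial time in `(record, chunk)`. [cite: AroraBarak2009, §1.3] -/
theorem attemptOf_codeFP : CodeFP rejArgE (pairE bitE intE) (fun p => attemptOf p.1 p.2) := by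
  have hacc : CodeFP rejArgE accCtxE (fun p => p.1.1) := (fst _ _).fst'
  have hw : CodeFP rejArgE unE (fun p => p.1.2.1) := (fst _ _).snd'.fst'
  have hP : CodeFP rejArgE unE (fun p => p.1.1.2.2.2.2.1) := hacc.snd'.snd'.snd'.snd'.fst'
  have hc : CodeFP rejArgE encodeRat (fun p => p.1.1.2.1) := hacc.snd'.fst'
  have hl : CodeFP rejArgE strE (fun p => p.2) := snd _ _
  have hw1 : CodeFP rejArgE unE (fun p => p.1.2.1 + 1) := (unSucc.comp hw :)
  -- the two blocks read off the chunk
  have hO : CodeFP rejArgE natE (fun p => readO p.1.2.1 p.2) := (strVal.comp (strTake.comp (hw1.pair hl)) :)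
  have hU : CodeFP rejArgE natE (fun p => readU p.1.2.1 p.1.1.2.2.2.2.1 p.2) :=
    (strVal.comp (strTake.comp (hP.pair (strDrop.comp (hw1.pair hl)))) :)
  -- the window point `round c + o - 2ʷ`
  have hx : CodeFP rejArgE intE (fun p => round p.1.1.2.1 + (readO p.1.2.1 p.2 : ℤ) - 2 ^ p.1.2.1) :=
    (intSub.comp ((intAdd.comp ((ratRound.comp hc).pair (intOfNat.comp hO))).pair
      (intOfNat.comp (natPow.comp ((const _ 2).pair hw)))) :).congr fun p => by push_cast; ring
  have hnum : CodeFP rejArgE natE (fun p => accNumOf p.1.1 (round p.1.1.2.1 + (readO p.1.2.1 p.2 : ℤ) - 2 ^ p.1.2.1)) :=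
    (accNumOf_codeFP.comp (hacc.pair hx) :)
  have htest : CodeFP rejArgE bitE
      (fun p => decide (readU p.1.2.1 p.1.1.2.2.2.2.1 p.2 < accNumOf p.1.1 (round p.1.1.2.1 + (readO p.1.2.1 p.2 : ℤ) - 2 ^ p.1.2.1))) :=
    (natLt.comp (hU.pair hnum) :)
  have hyes : CodeFP rejArgE (pairE bitE intE) (fun p => (true, round p.1.1.2.1 + (readO p.1.2.1 p.2 : ℤ) - 2 ^ p.1.2.1)) :=
    (const _ true).pair hx
  exact (htest.ite hyes (const _ ((false, 0) : Bool × ℤ))).congr fun p => by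
    unfold attemptOf
    by_cases h : readU p.1.2.1 p.1.1.2.2.2.2.1 p.2 < accNumOf p.1.1 (round p.1.1.2.1 + (readO p.1.2.1 p.2 : ℤ) - 2 ^ p.1.2.1)
    · rw [decide_eq_true h, if_pos h]; rfl
    · rw [decide_eq_false h, if_neg h]; rfl

/-- **The rejection sampler is typed polynomial time** in the record and the coin string.
[cite: GentryPeikertVaikuntanathan2008, §4.1; AroraBarak2009, §1.3] -/
theorem rejOf_codeFP : CodeFP rejArgE intE (fun p => rejOf p.1 p.2) := by
  have hacc : CodeFP rejArgE accCtxE (fun p => p.1.1) := (fst _ _).fst'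
  have hw : CodeFP rejArgE unE (fun p => p.1.2.1) := (fst _ _).snd'.fst'
  have hR : CodeFP rejArgE unE (fun p => p.1.2.2) := (fst _ _).snd'.snd'
  have hP : CodeFP rejArgE unE (fun p => p.1.1.2.2.2.2.1) := hacc.snd'.snd'.snd'.snd'.fst'
  have hc : CodeFP rejArgE encodeRat (fun p => p.1.1.2.1) := hacc.snd'.fst'
  have hl : CodeFP rejArgE strE (fun p => p.2) := snd _ _
  have hK : CodeFP rejArgE unE (fun p => p.1.2.1 + 1 + p.1.1.2.2.2.2.1) :=
    (unAdd.comp ((unSucc.comp hw).pair hP) :)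
  -- the chunks
  have hchunks : CodeFP rejArgE (rawE strE)
      (fun p => (List.range p.1.2.2).map fun t => (p.2.drop (t * (p.1.2.1 + 1 + p.1.1.2.2.2.2.1))).take (p.1.2.1 + 1 + p.1.1.2.2.2.2.1)) :=
    (strChunks.comp (hR.pair (hK.pair hl)) :)
  -- the attempts, with the record as context
  have hatt : CodeFP (pairE rejCtxE strE) (pairE bitE intE) (fun p => attemptOf p.1 p.2) := attemptOf_codeFP
  have hmap := (map hatt).comp ((fst _ _).pair hchunks)
  have hfold := foldl_pick_codeFP.comp hmap
  have hres : CodeFP rejArgE (pairE bitE intE)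
      (fun p => (((List.range p.1.2.2).map fun t => (p.2.drop (t * (p.1.2.1 + 1 + p.1.1.2.2.2.2.1))).take
        (p.1.2.1 + 1 + p.1.1.2.2.2.2.1)).map (attemptOf p.1)).foldl pick (false, 0)) :=
    hfold.congr fun _ => rfl
  exact ((hres.fst'.ite hres.snd' (ratRound.comp hc)).congr fun _ => rfl)

end Program

end GaussRejMachine

end Literature.Computability.Cryptography

end
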